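import Mathlib
import HarnessLib
import Summits.HubbardSuperconductivity.HubbardSuperconductivity.Theorems.KLProgrammeC4aSliceProfile

/-!
# Route `KLProgramme` — crux C4a, value layer (k = 0): the FIRST RADIAL / FREQUENCY MOMENT of the slice symbol as a level profile —
# `∫_{(−r,r)} ‖ŝ(q₀,ξ)‖·|ξ| dξ ≤ 2|c|·Λ′`, `∫ ‖ŝ(q₀,ξ)‖·|q₀| dξ ≤ 2|c|·Λ′`, and `= 0` for `|q₀| > Λ′` — the `Λ_n²` (`16^{−n}`) of the value law

Cell `gate-hubbard-kl`, lane hubbard-kl-c4a-1 (g4); located risk #12 «(C)-VALUE-K0» (memo HOME/hubbard-kl-c4a-1/C4A-PLAN.md §17, §20.4 (iii)).  Every value theorem of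
`…C4aTubeTadpoleValue` / `…C4aLevelDensityRadialValue` / `…C4aLevelDensityRadialVertex` ends in the first radial moment `∫_{(−r,r)} ‖f(ρ)‖·|ρ| dρ` of the
slice profile `f = ξ ↦ sliceSymbolFnXi c 0 Λ Λ′ q₀ ξ` (LAYER 1: `c = βL²`, `Λ = Λ_{n+1}`, `Λ′ = Λ_n`), paired with `|q₀|` for the frequency flip.  Pointwise,
`‖ŝ(q₀,ξ)‖ = |W|·|c|/√(q₀² + ξ²) ≤ |c|/√(q₀²+ξ²)` (`abs_sliceWeightFn_le_one`, `norm_resolventFnXi`), so `‖ŝ‖·|ξ| ≤ |c|` and `‖ŝ‖·|q₀| ≤ |c|`, and `ŝ(q₀,·) ≡ 0`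
off `|ξ| ≤ Λ′` and for `|q₀| > Λ′` (`sliceWeightFn_eq_zero_of_not_mem`).  Hence per frequency both moments are `≤ 2|c|·Λ′`, nonzero only for the
`≤ 2(βΛ′/π + 1)` Matsubara frequencies with `|q₀| ≤ Λ′`: summed with `1/β` this is the `Λ_n²` law (the Matsubara count is the consumer's bookkeeping,
`card_filter_matsubaraFreq_le`).

* §1 pointwise: `norm_sliceSymbolFnXi_mul_abs_le` (`‖ŝ(q₀,ξ)‖·|ξ| ≤ |c|`), `norm_sliceSymbolFnXi_mul_abs_freq_le` (`‖ŝ(q₀,ξ)‖·|q₀| ≤ |c|`),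
  `sliceSymbolFnXi_eq_zero_of_lt_abs_freq` (`|q₀| > Λ′ ⇒ ŝ(q₀,·) ≡ 0`);
* §2 integrated: `setIntegral_norm_sliceSymbolFnXi_mul_abs_le` (`∫_{(−r,r)} ‖ŝ‖·|ξ| ≤ 2|c|Λ′`), `…_mul_abs_freq_le` (`∫_{(−r,r)} ‖ŝ‖·|q₀| ≤ 2|c|Λ′`),
  `…_mul_abs_add_le` (`∫ ‖ŝ‖·(|ξ|+|q₀|) ≤ 4|c|Λ′`) and the vanishing version `…_eq_zero_of_lt_abs_freq` for `|q₀| > Λ′`.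

Pure calculus on the Literature symbol; nothing is asserted about the Hubbard model.  References: Salmhofer 1999 §4.2.5 (4.70)–(4.71) [cite: Salmhofer1999];
BGM 2006 §2.1 (2.3) [cite: BenfattoGiulianiMastropietro2006].
-/

noncomputable section

namespace Summit.HubbardSuperconductivity.HubbardSuperconductivity.Theorems.C4a

set_option linter.dupNamespace false -- summit = problem name (single-conjunct summit), D-0017

open Real Set MeasureTheory
open Literature.MathematicalPhysics.QuantumLattice

/-! ## §1 Pointwise -/

/-- `‖ŝ(q₀,ξ)‖ ≤ |c|/√(q₀²+ξ²)`-type bound in product form: `‖ŝ(q₀,ξ)‖·√(q₀²+ξ²) ≤ |c|` (weight in `[−1,1]`, resolvent `c/(ξ − iq₀)`). -/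
theorem norm_sliceSymbolFnXi_mul_sqrt_le (c Λ Λ' w ξ : ℝ) :
    ‖sliceSymbolFnXi c 0 Λ Λ' w ξ‖ * Real.sqrt (w ^ 2 + ξ ^ 2) ≤ |c| := by
  unfold sliceSymbolFnXi resolventFnXi
  rw [norm_mul, Complex.norm_real, Real.norm_eq_abs, norm_div, Complex.norm_real, Real.norm_eq_abs]
  have hden : ‖-Complex.I * (((w + 0 : ℝ)) : ℂ) + (ξ : ℂ)‖ = Real.sqrt (w ^ 2 + ξ ^ 2) := by
    rw [Complex.norm_eq_sqrt_sq_add_sq]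
    congr 1
    simp only [add_zero, Complex.add_re, Complex.mul_re, Complex.neg_re, Complex.I_re, neg_zero, Complex.ofReal_re, zero_mul,
      Complex.neg_im, Complex.I_im, Complex.ofReal_im, mul_zero, sub_zero, zero_add, Complex.add_im, Complex.mul_im, neg_mul, one_mul,
      add_zero]
    ring
  rw [hden]
  by_cases h0 : Real.sqrt (w ^ 2 + ξ ^ 2) = 0
  · rw [h0, mul_zero]; exact abs_nonneg _
  · calc |sliceWeightFn Λ Λ' w ξ| * (|c| / Real.sqrt (w ^ 2 + ξ ^ 2)) * Real.sqrt (w ^ 2 + ξ ^ 2)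
        = |sliceWeightFn Λ Λ' w ξ| * |c| := by field_simp
      _ ≤ 1 * |c| := mul_le_mul_of_nonneg_right (abs_sliceWeightFn_le_one Λ Λ' w ξ) (abs_nonneg _)
      _ = |c| := one_mul _

/-- **`‖ŝ(q₀,ξ)‖·|ξ| ≤ |c|`** (the radial moment weight costs nothing against the resolvent). -/
theorem norm_sliceSymbolFnXi_mul_abs_le (c Λ Λ' w ξ : ℝ) : ‖sliceSymbolFnXi c 0 Λ Λ' w ξ‖ * |ξ| ≤ |c| := by
  refine le_trans ?_ (norm_sliceSymbolFnXi_mul_sqrt_le c Λ Λ' w ξ)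
  refine mul_le_mul_of_nonneg_left ?_ (norm_nonneg _)
  rw [← Real.sqrt_sq_eq_abs]
  exact Real.sqrt_le_sqrt (by nlinarith [sq_nonneg w])

/-- **`‖ŝ(q₀,ξ)‖·|q₀| ≤ |c|`** (the frequency moment weight, for the Matsubara flip `±q₀`). -/
theorem norm_sliceSymbolFnXi_mul_abs_freq_le (c Λ Λ' w ξ : ℝ) : ‖sliceSymbolFnXi c 0 Λ Λ' w ξ‖ * |w| ≤ |c| := by
  refine le_trans ?_ (norm_sliceSymbolFnXi_mul_sqrt_le c Λ Λ' w ξ)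
  refine mul_le_mul_of_nonneg_left ?_ (norm_nonneg _)
  rw [← Real.sqrt_sq_eq_abs]
  exact Real.sqrt_le_sqrt (by nlinarith [sq_nonneg ξ])

/-- **High frequencies see no slice**: `|q₀| > Λ′ ⇒ ŝ(q₀, ξ) = 0` for every level (`0 < Λ ≤ Λ′`). -/
theorem sliceSymbolFnXi_eq_zero_of_lt_abs_freq {Λ Λ' : ℝ} (hΛ : 0 < Λ) (hΛΛ' : Λ ≤ Λ') (c : ℝ) {w : ℝ} (hw : Λ' < |w|) (ξ : ℝ) :
    sliceSymbolFnXi c 0 Λ Λ' w ξ = 0 := by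
  have hΛ' : 0 < Λ' := hΛ.trans_le hΛΛ'
  have hsq : Λ' ^ 2 < ξ ^ 2 + w ^ 2 := by
    have h1 : Λ' ^ 2 < |w| ^ 2 := by nlinarith [abs_nonneg w]
    rw [sq_abs] at h1
    nlinarith [sq_nonneg ξ]
  have hmem := (sliceWeightFn_eq_zero_of_not_mem hΛ hΛΛ' (ξ := w) (ω := ξ) (Or.inr hsq)).1
  unfold sliceSymbolFnXi
  rw [hmem, Complex.ofReal_zero, zero_mul]

/-! ## §2 Integrated over the level window -/

section Integrated

variable {Λ Λ' : ℝ} (hΛ : 0 < Λ) (hΛΛ' : Λ ≤ Λ') (c w r : ℝ)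
include hΛ hΛΛ'

/-- The profile `ξ ↦ ‖ŝ(q₀,ξ)‖·|ξ|` is supported in `[−Λ′, Λ′]` and bounded by `|c|`, hence its integral over any level window is `≤ 2|c|Λ′`:
**`∫_{(−r,r)} ‖ŝ(q₀,ξ)‖·|ξ| dξ ≤ 2|c|·Λ′`** — the first radial MOMENT of the slice at one frequency. -/
theorem setIntegral_norm_sliceSymbolFnXi_mul_abs_le :
    ∫ ξ in Ioo (-r) r, ‖sliceSymbolFnXi c 0 Λ Λ' w ξ‖ * |ξ| ≤ 2 * |c| * Λ' := by
  have hΛ' : 0 < Λ' := hΛ.trans_le hΛΛ'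
  -- pointwise: the integrand is ≤ |c| on [−Λ′, Λ′] and 0 outside
  have hpt : ∀ ξ, ‖sliceSymbolFnXi c 0 Λ Λ' w ξ‖ * |ξ| ≤ Set.indicator (Icc (-Λ') Λ') (fun _ => |c|) ξ := by
    intro ξ
    by_cases hξ : ξ ∈ Icc (-Λ') Λ'
    · rw [Set.indicator_of_mem hξ]; exact norm_sliceSymbolFnXi_mul_abs_le c Λ Λ' w ξ
    · rw [Set.indicator_of_notMem hξ]
      have hlt : Λ' < |ξ| := by
        rw [mem_Icc, not_and_or, not_le, not_le] at hξ
        rcases hξ with h | h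
        · rw [abs_of_neg (by linarith)]; linarith
        · rw [abs_of_pos (by linarith)]; exact h
      rw [sliceSymbolFnXi_eq_zero_of_lt_abs hΛ hΛΛ' c 0 w hlt, norm_zero, zero_mul]
  have hint : Integrable (Set.indicator (Icc (-Λ') Λ') (fun _ : ℝ => |c|)) (volume : Measure ℝ) := by
    refine (integrable_indicator_iff measurableSet_Icc).2 ?_
    exact integrableOn_const (hs := by rw [Real.volume_Icc]; exact ENNReal.ofReal_ne_top)
  have hind : IntegrableOn (Set.indicator (Icc (-Λ') Λ') (fun _ : ℝ => |c|)) (Ioo (-r) r) := hint.integrableOn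
  calc ∫ ξ in Ioo (-r) r, ‖sliceSymbolFnXi c 0 Λ Λ' w ξ‖ * |ξ|
      ≤ ∫ ξ in Ioo (-r) r, Set.indicator (Icc (-Λ') Λ') (fun _ => |c|) ξ :=
        integral_mono_of_nonneg (Filter.Eventually.of_forall fun ξ => by positivity) hind (Filter.Eventually.of_forall hpt)
    _ ≤ ∫ ξ, Set.indicator (Icc (-Λ') Λ') (fun _ => |c|) ξ :=
        setIntegral_le_integral hint (Filter.Eventually.of_forall fun ξ => Set.indicator_nonneg (fun _ _ => abs_nonneg c) ξ)
    _ = 2 * |c| * Λ' := by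
        rw [integral_indicator measurableSet_Icc, setIntegral_const, Real.volume_real_Icc_of_le (by linarith)]
        simp only [smul_eq_mul]; ring


/-- **`∫_{(−r,r)} ‖ŝ(q₀,ξ)‖·|q₀| dξ ≤ 2|c|·Λ′`** — the first FREQUENCY moment of the slice at one frequency (for the Matsubara flip `±q₀`). -/
theorem setIntegral_norm_sliceSymbolFnXi_mul_abs_freq_le :
    ∫ ξ in Ioo (-r) r, ‖sliceSymbolFnXi c 0 Λ Λ' w ξ‖ * |w| ≤ 2 * |c| * Λ' := by
  have hΛ' : 0 < Λ' := hΛ.trans_le hΛΛ'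
  have hpt : ∀ ξ, ‖sliceSymbolFnXi c 0 Λ Λ' w ξ‖ * |w| ≤ Set.indicator (Icc (-Λ') Λ') (fun _ => |c|) ξ := by
    intro ξ
    by_cases hξ : ξ ∈ Icc (-Λ') Λ'
    · rw [Set.indicator_of_mem hξ]; exact norm_sliceSymbolFnXi_mul_abs_freq_le c Λ Λ' w ξ
    · rw [Set.indicator_of_notMem hξ]
      have hlt : Λ' < |ξ| := by
        rw [mem_Icc, not_and_or, not_le, not_le] at hξ
        rcases hξ with h | h
        · rw [abs_of_neg (by linarith)]; linarith
        · rw [abs_of_pos (by linarith)]; exact h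
      rw [sliceSymbolFnXi_eq_zero_of_lt_abs hΛ hΛΛ' c 0 w hlt, norm_zero, zero_mul]
  have hint : Integrable (Set.indicator (Icc (-Λ') Λ') (fun _ : ℝ => |c|)) (volume : Measure ℝ) := by
    refine (integrable_indicator_iff measurableSet_Icc).2 ?_
    exact integrableOn_const (hs := by rw [Real.volume_Icc]; exact ENNReal.ofReal_ne_top)
  calc ∫ ξ in Ioo (-r) r, ‖sliceSymbolFnXi c 0 Λ Λ' w ξ‖ * |w|
      ≤ ∫ ξ in Ioo (-r) r, Set.indicator (Icc (-Λ') Λ') (fun _ => |c|) ξ :=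
        integral_mono_of_nonneg (Filter.Eventually.of_forall fun ξ => by positivity) hint.integrableOn (Filter.Eventually.of_forall hpt)
    _ ≤ ∫ ξ, Set.indicator (Icc (-Λ') Λ') (fun _ => |c|) ξ :=
        setIntegral_le_integral hint (Filter.Eventually.of_forall fun ξ => Set.indicator_nonneg (fun _ _ => abs_nonneg c) ξ)
    _ = 2 * |c| * Λ' := by
        rw [integral_indicator measurableSet_Icc, setIntegral_const, Real.volume_real_Icc_of_le (by linarith)]
        simp only [smul_eq_mul]; ring

/-- **Both moments together**: `∫_{(−r,r)} ‖ŝ(q₀,ξ)‖·(|ξ| + |q₀|) dξ ≤ 4|c|·Λ′` (the `d(ρ) = D·(|ρ| + |q₀|)` shape of (L3-val)). -/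
theorem setIntegral_norm_sliceSymbolFnXi_mul_abs_add_le :
    ∫ ξ in Ioo (-r) r, ‖sliceSymbolFnXi c 0 Λ Λ' w ξ‖ * (|ξ| + |w|) ≤ 4 * |c| * Λ' := by
  have hΛ' : 0 < Λ' := hΛ.trans_le hΛΛ'
  have hpt : ∀ ξ, ‖sliceSymbolFnXi c 0 Λ Λ' w ξ‖ * (|ξ| + |w|) ≤ Set.indicator (Icc (-Λ') Λ') (fun _ => 2 * |c|) ξ := by
    intro ξ
    by_cases hξ : ξ ∈ Icc (-Λ') Λ'
    · rw [Set.indicator_of_mem hξ, mul_add]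
      have h1 := norm_sliceSymbolFnXi_mul_abs_le c Λ Λ' w ξ
      have h2 := norm_sliceSymbolFnXi_mul_abs_freq_le c Λ Λ' w ξ
      linarith
    · rw [Set.indicator_of_notMem hξ]
      have hlt : Λ' < |ξ| := by
        rw [mem_Icc, not_and_or, not_le, not_le] at hξ
        rcases hξ with h | h
        · rw [abs_of_neg (by linarith)]; linarith
        · rw [abs_of_pos (by linarith)]; exact h
      rw [sliceSymbolFnXi_eq_zero_of_lt_abs hΛ hΛΛ' c 0 w hlt, norm_zero, zero_mul]
  have hint : Integrable (Set.indicator (Icc (-Λ') Λ') (fun _ : ℝ => 2 * |c|)) (volume : Measure ℝ) := by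
    refine (integrable_indicator_iff measurableSet_Icc).2 ?_
    exact integrableOn_const (hs := by rw [Real.volume_Icc]; exact ENNReal.ofReal_ne_top)
  calc ∫ ξ in Ioo (-r) r, ‖sliceSymbolFnXi c 0 Λ Λ' w ξ‖ * (|ξ| + |w|)
      ≤ ∫ ξ in Ioo (-r) r, Set.indicator (Icc (-Λ') Λ') (fun _ => 2 * |c|) ξ :=
        integral_mono_of_nonneg (Filter.Eventually.of_forall fun ξ => by positivity) hint.integrableOn (Filter.Eventually.of_forall hpt)
    _ ≤ ∫ ξ, Set.indicator (Icc (-Λ') Λ') (fun _ => 2 * |c|) ξ :=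
        setIntegral_le_integral hint (Filter.Eventually.of_forall fun ξ => Set.indicator_nonneg (fun _ _ => by positivity) ξ)
    _ = 4 * |c| * Λ' := by
        rw [integral_indicator measurableSet_Icc, setIntegral_const, Real.volume_real_Icc_of_le (by linarith)]
        simp only [smul_eq_mul]; ring

/-- **High frequencies contribute nothing**: for `|q₀| > Λ′` both moments vanish. -/
theorem setIntegral_norm_sliceSymbolFnXi_mul_abs_eq_zero_of_lt_abs_freq (hw : Λ' < |w|) :
    ∫ ξ in Ioo (-r) r, ‖sliceSymbolFnXi c 0 Λ Λ' w ξ‖ * (|ξ| + |w|) = 0 := by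
  refine setIntegral_eq_zero_of_forall_eq_zero fun ξ _ => ?_
  rw [sliceSymbolFnXi_eq_zero_of_lt_abs_freq hΛ hΛΛ' c hw ξ, norm_zero, zero_mul]

end Integrated

end Summit.HubbardSuperconductivity.HubbardSuperconductivity.Theorems.C4a

end
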